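import Literature.MathematicalPhysics.QuantumFieldTheory.Balaban1983to89.Node00.CarriersB8CubeDentedRec
import Literature.MathematicalPhysics.QuantumFieldTheory.Balaban1983to89.Node00.TorusCoverCubeMemberPrint
import Literature.MathematicalPhysics.QuantumFieldTheory.Balaban1983to89.Node00.TorusCoverGaugeLiftShift

/-!
# NODE 00 — THE R7 DOOR, STAGE 3a: THE PRINT DATUM `𝔔` OF A GRID CUBE AS A RECORD DATUM `Node00.CubeB8DZ` over the constant ambient family «every level = the collared print cube
# `□̃ᶻ`» (dag-n07-e's `propCubeP` FOR THE RECORD's CENTRED TOWER), and its input class `A_k` fed from the run's (1.7)∕(1.9) bounds through the TOP-ANCHORED lift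

Cell `pub-ymgap`, width seat `pub-ymgap-dag-n07-w3` g10 (N05-REC R7 pen; LEAD PEN dag-n05-e).  ONE DEFINITION (`propCubePZ`) + bookkeeping; `--kind definition --supports stmt-QuantumFields-20541`
(K0⁷; count-neutral).  CONSUMED BY NAME, nothing modified: this seat's `Node00.CarriersB8CubeDentedRec` (`CubeB8DZ`), dag-n07-e's `Node00.TorusCoverCubeMemberPrint` (`cornerP`, `sideP`,
`le_sideP`, `cubeIdxP'`, `cover_image_Ω_cubeIdxP'_subset` — the engine datum `propCubeP` over the constant family `cubeIdxP'.Ω ≡ □̃`), this lineage's g9 FILE 39b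
`Node00.TorusCoverGaugeLiftShift.inAk_coverLiftShift_of_top`, dag-n05-d's `B8Eq131CubesRec` (`cubeZ tcubeZ sqLoZ sqHiZ bLoZ bHiZ`, `tLo_eq`, `tHi_eq`, `mem_cube_iff`) and
`B8Eq119TwistedAxialRec` (`flmZ`, `underZ_flmZ`, `underZ_iff_flmZ_eq`), the (T2) dictionary `B8Eq131CubesRecDictionary.image_add_ctrShift_tcubeZ`.
[6] = [Balaban1985RegularSpaces]; [15] = [Balaban1985Variational]; [I] = [Balaban1987RG1].

WHY (the K0 road's own device, FOR THE RECORD).  On the engine side the per-datum crown is applied NOT over the run's family `{Ω_j}` (where print's box may stick out of `Ω_j`)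
but over the CONSTANT family «`Ω′_j := □̃` for every `j`» of the datum itself (dag-n07-e's `cubeIdxP' ∕ propCubeP`): «□ ⊂ Ω_k», «□̃ ⊂ Ω_{k−1}» and the block law are then automatic,
and the smallness class `A_k({□̃}, α₀)` is fed from the run's (1.7)∕(1.9) bounds through «`π(□̃) ⊆ Ω_{j−1}(s)`» (`cover_image_Ω_cubeIdxP'_subset`); the dent re-enters only at the
(153) row, as a kernel-finer family (REFiner).  THIS FILE is that device for the record datum: `propCubePZ` over «`Ω′_j := □̃ᶻ = tcubeZ …`», whose ONE non-trivial field is the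
CENTRED block law of `□̃ᶻ` (§1), and whose `A_k` input at the top-anchored lift `x ↦ π(x + c_n·𝟙)` is the engine's, one (T2) rewrite away (§3).

WHAT IS DEFINED ∕ PROVED (sorry-free).
* §1 `tcubeZ_eq_cubeZ_two_mul` (`□̃ᶻ = cubeZ L a M (2ρ) k k`: the collared cube is the top cube of the datum with collar `2ρ`), ★ `tcubeZ_blockSat` ∕ `tcubeZ_blocks_flmZ` (`□̃ᶻ` is a union
  of CENTRED `Lᵏ`-blocks: `flmZ L k x = flmZ L k y → x ∈ □̃ᶻ → y ∈ □̃ᶻ`, odd `L`).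
* §2 ★★ `propCubePZ P n hn M ρ hρ a : CubeB8DZ P.d P.L n (fun _ => tcubeZ P.L (cornerP P M ρ a) (sideP P M ρ) ρ n)` — scale `n`, corner `cornerP`, side `sideP`, collar `ρ` EXACTLY (print's
  `R₁M₁ ≥ L`), the size laws as in `propCubeP`, «□̃ᶻ ⊂ Ω′_{n−1}» by `rfl`, the centred block law by §1; `rfl` readings `propCubePZ_k ∕ _a ∕ _M ∕ _ρ`; `propCubePZ_sq_top` (EMPTY DENT:
  `Ω′_n ∩ … = □_nᶻ`, i.e. `sq n = cubeZ … n n`).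
* §3 ★★ `inAk_coverLiftShift_propCubePZ_of_top`: the run's bounds `PlaqSmallOn ∕ CoDivSmallOn` on the top regions at the torus scales `lvl j`, the inclusions
  «`π '' tcube … ⊆ Ω_{lvl j}`-region» (ENGINE `□̃`, as dag-n07-e's lemma delivers them) and the tolerances give `InAk L n η α (fun _ => tcubeZ …) (fun x μ => ιSU (U ⟨π(x + c_n·𝟙), μ⟩))`.
HONEST FRAMING: one definition + set bookkeeping + one rewrite of g9's input row; NO estimate of [6]∕[15]∕[I]; `HThm4Rec` UNDISCHARGED (caveat (C-S3-1)); N07 ∕ N05 NOT discharged; counts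
unmoved; one finite 𝕋⁴ programme at fixed ε — R4 closes the conditional finite-𝕋⁴ rung `BalabanLadder.UV` only; the YM mass gap (Clay) is NOT proved by any of this; nothing continuum ∕
ℝ⁴ ∕ OS.  No `sorry`, no `instance`, no `notation`.

References: [6] p.98 («□̃», «M is a multiple of R₁M₁»), (1.3)–(1.9) p.77, (1.130)–(1.131) p.99; [15] (144) p.300; [I] (0.1) p.251, (0.3)–(0.4) pp.252–253; [Balaban1988Convergent] (1.4) p.247.
-/

noncomputable section

namespace Literature.MathematicalPhysics.QuantumFieldTheory.Balaban1983to89.Node00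

open scoped Matrix.Norms.L2Operator
open B7Prop1Local (InBox)
open BlockAveragingZd (ctrShift)
open B8Ineq132 (InAk)
open B8Eq131Cubes (tLo tHi ctr gs cube tcube)
open B8Eq131CubesRec (boxZ cubeZ tcubeZ bLoZ bHiZ sqLoZ sqHiZ)
open B8Eq131CubesRecDictionary (image_add_ctrShift_tcubeZ)
open B8Eq119TwistedAxialRec (UnderZ flmZ underZ_flmZ underZ_iff_flmZ_eq)
open B15Eq112TorusCover (cover)
open B14DomainGeom (Pt)

/-! ## §1  `□̃ᶻ` is the `2ρ`-collared top cube and a union of centred `Lᵏ`-blocks -/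

section Blocks

variable {d : ℕ}

/-- `□̃ᶻ = cubeZ L a M (2ρ) k k`: the collared cube `□̃^{(k)} = [a − 2ρ, a + M − 1 + 2ρ]ᵈ` blown up `k` times (centred) is the top cube of the cube family with collar `2ρ`
(`gs L 0 = 1`). [cite: Balaban1985RegularSpaces, p.98 («□̃»), (1.131) p.99; Balaban1987RG1, (0.3) p.252] -/
theorem tcubeZ_eq_cubeZ_two_mul (L : ℕ) (a : B7Prop1Explicit.Site d) (M ρ k : ℕ) : tcubeZ L a M ρ k = cubeZ L a M (2 * ρ) k k := by
  ext x
  simp only [tcubeZ, cubeZ, sqLoZ, sqHiZ, B8Eq131CubesRec.tLo_eq L, B8Eq131CubesRec.tHi_eq L, Nat.sub_self, B8Eq131Cubes.gs_zero, mul_one, Set.mem_setOf_eq]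

/-- ★ **`□̃ᶻ` IS A UNION OF CENTRED `Lᵏ`-BLOCKS** (odd `L`): a site of `□̃ᶻ` carries its whole centred `k`-block into `□̃ᶻ` (dag-n05-d's `B8Eq131CubesRec.mem_cube_iff` at collar `2ρ`).
[cite: Balaban1985RegularSpaces, p.98 («for every j the cube □_j is a sum of the big blocks»); Balaban1987RG1, (0.3) p.252] -/
theorem tcubeZ_blockSat {L : ℕ} (hL : Odd L) {a : B7Prop1Explicit.Site d} {M ρ k : ℕ} {x y : B7Prop1Explicit.Site d} (hx : x ∈ tcubeZ L a M ρ k)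
    (hy : UnderZ L k (flmZ L k x) y) : y ∈ tcubeZ L a M ρ k := by
  rw [tcubeZ_eq_cubeZ_two_mul] at hx ⊢
  obtain ⟨z, hz, hzx⟩ := (B8Eq131CubesRec.mem_cube_iff hL).1 hx
  have hzf : flmZ L k x = z := (underZ_iff_flmZ_eq hL k z x).1 hzx
  exact (B8Eq131CubesRec.mem_cube_iff hL).2 ⟨z, hz, hzf ▸ hy⟩

/-- ★ The centred block law of `□̃ᶻ` in `flmZ` letters (the field `CubeB8DZ.blocks` for the constant family «`Ω′ ≡ □̃ᶻ`», odd `L`). [cite: Balaban1985RegularSpaces, (1.3) p.77, p.98; Balaban1987RG1, (0.3) p.252] -/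
theorem tcubeZ_blocks_flmZ {L : ℕ} (hL : Odd L) (a : B7Prop1Explicit.Site d) (M ρ k : ℕ) ⦃x y : B7Prop1Explicit.Site d⦄ (h : flmZ L k x = flmZ L k y)
    (hx : x ∈ tcubeZ L a M ρ k) : y ∈ tcubeZ L a M ρ k :=
  tcubeZ_blockSat hL hx (h ▸ underZ_flmZ hL k y)

end Blocks

/-! ## §2  The print datum of a grid cube as a record datum over the constant family `Ω′ ≡ □̃ᶻ` -/

section Datum

variable (P : Params)

/-- ★★ (RECORD TWIN of dag-n07-e's `propCubeP`.) **THE PRINT DATUM `𝔔` OF A GRID CUBE as a `Node00.CubeB8DZ` datum over the CONSTANT ambient family «`Ω′_j := □̃ᶻ`»**: scale `k := n`,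
corner `cornerP` (on the `ρ`-grid), side `sideP` (a multiple of `ρ`, «11d < M′»), collar `ρ` EXACTLY — print's cube of [6] p. 98 ∕ [15] (144) at big-block size `ρ = R₁M₁ ≥ L`, read
on the RECORD's centred tower; «□̃ᶻ ⊂ Ω′_{n−1}» by construction, the centred block law by `tcubeZ_blocks_flmZ` (odd `L`: `P.hL.1`), EMPTY dent.
[cite: Balaban1985RegularSpaces, p.98, (1.130) p.99, Prop. 6 p.99; Balaban1985Variational, (144) p.300; Balaban1987RG1, (0.3)–(0.4) pp.252–253] -/
def propCubePZ (n : ℕ) (hn : 1 ≤ n) (M ρ : ℕ) (hρ : P.L ≤ ρ) (a : Pt P.d) :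
    CubeB8DZ P.d P.L n (fun _ => tcubeZ P.L (cornerP P M ρ a) (sideP P M ρ) ρ n) where
  k := n
  a := cornerP P M ρ a
  M := sideP P M ρ
  ρ := ρ
  one_le_k := hn
  k_le := le_rfl
  L_le_ρ := hρ
  ρ_le_M := Nat.le_mul_of_pos_right ρ (Nat.succ_pos _)
  big := by have := le_sideP (P := P) M (lt_of_lt_of_le P.L_pos hρ); omega
  L_le_dM := by
    have hd := P.hd
    have h1 : P.L ≤ sideP P M ρ := hρ.trans (Nat.le_mul_of_pos_right ρ (Nat.succ_pos _))
    calc P.L ≤ sideP P M ρ := h1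
      _ = 1 * sideP P M ρ := (one_mul _).symm
      _ ≤ P.d * sideP P M ρ := Nat.mul_le_mul_right _ hd
  tcube_sub := subset_rfl
  blocks := tcubeZ_blocks_flmZ P.hL.1 (cornerP P M ρ a) (sideP P M ρ) ρ n

/-- The datum's scale index is `n`. [cite: Balaban1985RegularSpaces, Prop. 6 p.99 (bookkeeping)] -/
@[simp] theorem propCubePZ_k (n : ℕ) (hn : 1 ≤ n) (M ρ : ℕ) (hρ : P.L ≤ ρ) (a : Pt P.d) : (propCubePZ P n hn M ρ hρ a).k = n := rfl

/-- The datum's side is `M′ = sideP P M ρ`. [cite: Balaban1985RegularSpaces, (1.130) p.99 (bookkeeping)] -/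
@[simp] theorem propCubePZ_M (n : ℕ) (hn : 1 ≤ n) (M ρ : ℕ) (hρ : P.L ≤ ρ) (a : Pt P.d) : (propCubePZ P n hn M ρ hρ a).M = sideP P M ρ := rfl

/-- The datum's collar width is `ρ`. [cite: Balaban1985RegularSpaces, p.98 (bookkeeping)] -/
@[simp] theorem propCubePZ_ρ (n : ℕ) (hn : 1 ≤ n) (M ρ : ℕ) (hρ : P.L ≤ ρ) (a : Pt P.d) : (propCubePZ P n hn M ρ hρ a).ρ = ρ := rfl

/-- The datum's corner is `cornerP P M ρ a`. [cite: Balaban1985RegularSpaces, p.98 (bookkeeping)] -/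
@[simp] theorem propCubePZ_a (n : ℕ) (hn : 1 ≤ n) (M ρ : ℕ) (hρ : P.L ≤ ρ) (a : Pt P.d) : (propCubePZ P n hn M ρ hρ a).a = cornerP P M ρ a := rfl

/-- **EMPTY DENT**: over the constant family `Ω′ ≡ □̃ᶻ` the dented top is the pure top cube, `Ω′_n = □_nᶻ` (odd `L ≥ 2`). [cite: Balaban1985Variational, (148)–(150) p.301; Balaban1985RegularSpaces, p.98] -/
theorem propCubePZ_sq_top (n : ℕ) (hn : 1 ≤ n) (M ρ : ℕ) (hρ : P.L ≤ ρ) (a : Pt P.d) :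
    (propCubePZ P n hn M ρ hρ a).sq n = cubeZ P.L (cornerP P M ρ a) (sideP P M ρ) ρ n n := by
  have hρ1 : 1 ≤ ρ := le_trans (le_trans (by norm_num) P.hL.2) hρ
  have h : cubeZ P.L (cornerP P M ρ a) (sideP P M ρ) ρ n n ⊆ tcubeZ P.L (cornerP P M ρ a) (sideP P M ρ) ρ n :=
    B8Eq131CubesRec.cube_subset_tcube P.hL.1 P.hL.2 hρ1 le_rfl
  have := (propCubePZ P n hn M ρ hρ a).sq_eq_cubeFam_of_subset h n
  rw [this]
  exact B8Eq131CubesAdmissibleRec.cubeFam_false_of_le P.L _ _ _ le_rfl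

end Datum

/-! ## §3  The input class `A_k({□̃ᶻ}, α)` of the record datum at the top-anchored lift, from the run's bounds -/

section Input

variable {P : Params} (N : ℕ) [NeZero N]

/-- ★★ **THE RUN's (1.7)∕(1.9)-TYPE BOUNDS GIVE `A_n({□̃ᶻ}, α)` FOR THE TOP-ANCHORED LIFT OF THE RECORD DATUM** — this lineage's g9 `inAk_coverLiftShift_of_top` at the constant family
`Ω′ ≡ □̃ᶻ` with `t := ctrShift L n·𝟙`, the inclusion hypothesis stated on the ENGINE collared cube `π '' tcube …` (exactly what dag-n07-e's `cover_image_Ω_cubeIdxP'_subset` delivers),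
via the (T2) identity `(· + t) '' □̃ᶻ = □̃`. [cite: Balaban1985RegularSpaces, (1.7)–(1.9) p.77, p.98; Balaban1988Convergent, (1.4) p.247; Balaban1987RG1, (0.1) p.251, (0.3) p.252] -/
theorem inAk_coverLiftShift_tcubeZ_of_top {Ω : ℕ → Set (Site P 0)} {Ω₀ : Set (Site P 0)} {kT : ℕ} {ε : ℕ → ℝ} (U : GaugeField P 0 (SU N))
    (hP : ∀ m, m ≤ kT → PlaqSmallOn (Sect2.omegaPlaqsTop Ω Ω₀ m) (ε m * P.eta m ^ 2) U)
    (hD : ∀ m, m ≤ kT → Sect2.CoDivSmallOn (Sect2.omegaBondsTop Ω Ω₀ m) (ε m * P.eta m ^ 3) U)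
    (a : Pt P.d) (M ρ n : ℕ) {α η : ℝ} (hη : 0 < η) (lvl : ℕ → ℕ) (hlvl : ∀ j, j ≤ n → lvl j ≤ kT)
    (hsub : ∀ j, j ≤ n → cover P '' tcube P.L a M ρ n ⊆ (if lvl j = 0 then Ω₀ else Ω (lvl j)))
    (htol2 : ∀ j, j ≤ n → ε (lvl j) * P.eta (lvl j) ^ 2 ≤ α * P.eta j ^ 2)
    (htol3 : ∀ j, j ≤ n → ε (lvl j) * P.eta (lvl j) ^ 3 ≤ α * P.eta j ^ 3) :
    InAk P.L n η α (fun _ => tcubeZ P.L a M ρ n) (fun x μ => ιSU N (U ⟨cover P (x + fun _ => (ctrShift P.L n : ℤ)), μ⟩)) := by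
  refine inAk_coverLiftShift_of_top N U hP hD (fun _ => (ctrShift P.L n : ℤ)) hη lvl hlvl (fun j hj => ?_) htol2 htol3
  rw [image_add_ctrShift_tcubeZ P.hL.1 a M ρ n]
  exact hsub j hj

end Input

end Literature.MathematicalPhysics.QuantumFieldTheory.Balaban1983to89.Node00

end

/-! ## Axiom audit (gate whitelist: `propext`, `Classical.choice`, `Quot.sound`) -/
#print axioms Literature.MathematicalPhysics.QuantumFieldTheory.Balaban1983to89.Node00.propCubePZ
#print axioms Literature.MathematicalPhysics.QuantumFieldTheory.Balaban1983to89.Node00.inAk_coverLiftShift_tcubeZ_of_top
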